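import Mathlib
import Literature.NumberTheory.LFunctions.LiouvilleTwoPowerModuli
import HarnessLib

/-!
# `DigitPolyUniformity`, line `Sketch` (cycle 7, the Klurman–Mangerel–Teräväinen class) — Stub KMT-M:
# the main term is negligible (λ twisted by a real character to a 2-power modulus over `[X, 2X]`)

In the Klurman–Mangerel–Teräväinen variance bound the main term is
`(χ₁(a)/φ(q)) · (h/X) · Σ_{X ≤ n ≤ 2X} λ(n)χ₁(n)` with `χ₁` a REAL character modulo `q = 2^k`.  For
2-power moduli there is no exceptional zero, and the tree PROVES (Green 2012, Theorem 3 and §1;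
Montgomery–Vaughan §11.3.1 Exercise 6 for `q = 2^t`) the named fact
`Literature.NumberTheory.LFunctions.green_liouville_character_twoPower`
(`green_liouville_character_twoPower_holds`): `‖Σ_{0 ≤ n < N} λ(n)χ(n)‖ ≤ K N e^{−c₂√log N}` for every
complex Dirichlet character `χ (mod 2^t)` with `2^t ≤ e^{c₂√log N}`.

`stub_kmt_mainTerm` repackages it for a real character over the range `X ≤ n ≤ 2X`: a real character
is viewed as a complex one through `ℝ →+* ℂ` (`MulChar.ringHomComp`), the complex sum is the cast of
the real sum, `Σ_{Icc X (2X)} = Σ_{range (2X+1)} − Σ_{range X}`, the admissible range at `X` implies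
the one at `2X + 1`, and `K(2X+1)e^{−c₂√log(2X+1)} + K X e^{−c₂√log X} ≤ 4 (max K 0) X e^{−c₂√log X}`
for `X ≥ 1`.  The trivial bound `|χ(a)| ≤ 1` is Mathlib's `DirichletCharacter.norm_le_one`.
-/

noncomputable section

namespace Summit.QuantumAdvantage.DigitPolyUniformity.SketchLAR.KMT

open Finset

/-- A real Dirichlet character is bounded by `1` in absolute value. [folklore] -/
theorem mainTerm_abs_char_le_one {k : ℕ} (χ : DirichletCharacter ℝ (2 ^ k)) (a : ZMod (2 ^ k)) :
    |χ a| ≤ 1 := by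
  rw [← Real.norm_eq_abs]
  exact χ.norm_le_one a

/-- The complex twisted Liouville sum of the complexification of a real character is the cast of
the real twisted sum. [folklore] -/
theorem mainTerm_sum_complex_eq {k : ℕ} (χ : DirichletCharacter ℝ (2 ^ k)) (s : Finset ℕ) :
    ∑ n ∈ s, ((ArithmeticFunction.liouville n : ℤ) : ℂ) *
        (χ.ringHomComp Complex.ofRealHom) (n : ZMod (2 ^ k)) =
      ((∑ n ∈ s, (ArithmeticFunction.liouville n : ℝ) * χ (n : ZMod (2 ^ k)) : ℝ) : ℂ) := by
  rw [Complex.ofReal_sum]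
  refine Finset.sum_congr rfl fun n _ => ?_
  rw [MulChar.ringHomComp_apply, Complex.ofRealHom_eq_coe, Complex.ofReal_mul,
    Complex.ofReal_intCast]

/-- The real form of the tree's `green_liouville_character_twoPower_holds` on `range N`, for a real
character, with a nonnegative constant. [folklore] -/
theorem mainTerm_abs_sum_range_le :
    ∃ c₂ : ℝ, 0 < c₂ ∧ ∃ K : ℝ, 0 ≤ K ∧ ∀ k N : ℕ,
      (2 : ℝ) ^ k ≤ Real.exp (c₂ * Real.sqrt (Real.log N)) →
      ∀ χ : DirichletCharacter ℝ (2 ^ k),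
        |∑ n ∈ range N, (ArithmeticFunction.liouville n : ℝ) * χ (n : ZMod (2 ^ k))| ≤
          K * N * Real.exp (-(c₂ * Real.sqrt (Real.log N))) := by
  obtain ⟨c₂, hc₂, K, hK⟩ :=
    Literature.NumberTheory.LFunctions.green_liouville_character_twoPower_holds
  refine ⟨c₂, hc₂, max K 0, le_max_right _ _, fun k N hkN χ => ?_⟩
  have h := hK k N (χ.ringHomComp Complex.ofRealHom) hkN
  rw [mainTerm_sum_complex_eq, Complex.norm_real, Real.norm_eq_abs] at h
  refine h.trans ?_
  gcongr
  exact le_max_left _ _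

/-- **Stub KMT-M (the main term is negligible: λ twisted by a real character to a 2-power modulus).**
From the tree's PROVED `green_liouville_character_twoPower_holds` (Green 2012 Thm 3 /
Montgomery–Vaughan §11.3.1 for `q = 2^t`, no exceptional zero): constants `c₂ > 0`, `K` with, for
all `k`, `X ≥ 1` with `2^k ≤ e^{c₂√log X}` and every REAL Dirichlet character `χ (mod 2^k)`:
`|χ(a)| ≤ 1` and `|Σ_{X≤n≤2X} λ(n)χ(n)| ≤ K X e^{−c₂√log X}`.
[cite: Green2012, Theorem 3 and §1 (remark on the Liouville function)] -/
theorem stub_kmt_mainTerm :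
    ∃ c₂ : ℝ, 0 < c₂ ∧ ∃ K : ℝ, ∀ k X : ℕ, 1 ≤ X →
      (2 : ℝ) ^ k ≤ Real.exp (c₂ * Real.sqrt (Real.log X)) →
      ∀ χ : DirichletCharacter ℝ (2 ^ k),
        (∀ a : ZMod (2 ^ k), |χ a| ≤ 1) ∧
        |∑ n ∈ Icc X (2 * X), (ArithmeticFunction.liouville n : ℝ) * χ (n : ZMod (2 ^ k))| ≤
          K * X * Real.exp (-(c₂ * Real.sqrt (Real.log X))) := by
  obtain ⟨c₂, hc₂, K, hK0, hK⟩ := mainTerm_abs_sum_range_le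
  refine ⟨c₂, hc₂, 4 * K, fun k X hX hk χ => ⟨mainTerm_abs_char_le_one χ, ?_⟩⟩
  set g : ℕ → ℝ := fun n => (ArithmeticFunction.liouville n : ℝ) * χ (n : ZMod (2 ^ k)) with hg
  have hX0 : (0 : ℝ) < X := by exact_mod_cast hX
  have hX1 : (1 : ℝ) ≤ X := by exact_mod_cast hX
  have hX2 : (X : ℝ) ≤ ((2 * X + 1 : ℕ) : ℝ) := by push_cast; linarith
  have hsqrt : Real.sqrt (Real.log X) ≤ Real.sqrt (Real.log ((2 * X + 1 : ℕ) : ℝ)) :=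
    Real.sqrt_le_sqrt (Real.log_le_log hX0 hX2)
  have hk2 : (2 : ℝ) ^ k ≤ Real.exp (c₂ * Real.sqrt (Real.log ((2 * X + 1 : ℕ) : ℝ))) :=
    hk.trans (Real.exp_le_exp.mpr (mul_le_mul_of_nonneg_left hsqrt hc₂.le))
  have hexp : Real.exp (-(c₂ * Real.sqrt (Real.log ((2 * X + 1 : ℕ) : ℝ)))) ≤
      Real.exp (-(c₂ * Real.sqrt (Real.log X))) :=
    Real.exp_le_exp.mpr (neg_le_neg (mul_le_mul_of_nonneg_left hsqrt hc₂.le))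
  have hsplit : ∑ n ∈ Icc X (2 * X), g n =
      ∑ n ∈ range (2 * X + 1), g n - ∑ n ∈ range X, g n := by
    rw [← Finset.sum_Ico_eq_sub _ (by omega : X ≤ 2 * X + 1), Finset.Ico_add_one_right_eq_Icc]
  have h1 := hK k (2 * X + 1) hk2 χ
  have h2 := hK k X hk χ
  set E : ℝ := Real.exp (-(c₂ * Real.sqrt (Real.log X))) with hE
  have hE0 : 0 < E := Real.exp_pos _
  calc |∑ n ∈ Icc X (2 * X), g n|
      = |∑ n ∈ range (2 * X + 1), g n - ∑ n ∈ range X, g n| := by rw [hsplit]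
    _ ≤ |∑ n ∈ range (2 * X + 1), g n| + |∑ n ∈ range X, g n| := abs_sub _ _
    _ ≤ K * ((2 * X + 1 : ℕ) : ℝ) * Real.exp (-(c₂ * Real.sqrt (Real.log ((2 * X + 1 : ℕ) : ℝ)))) +
          K * X * E := add_le_add h1 h2
    _ ≤ K * ((2 * X + 1 : ℕ) : ℝ) * E + K * X * E := by gcongr
    _ = K * (3 * X + 1) * E := by push_cast; ring
    _ ≤ K * (4 * X) * E := by
        gcongr
        linarith
    _ = 4 * K * X * E := by ring

end Summit.QuantumAdvantage.DigitPolyUniformity.SketchLAR.KMT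

end
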